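import Literature.NumberTheory.EllipticCurves.KatoRankBoundProofs

/-!
Sketch for the crux idea `lambda-adic-weight-line` (crux VerticalSelmerBound, stmt-BirchSwinnertonDyer-18432):
the Λ-module algebra of the weight-line reformulation, over the tree's `IwasawaAlgebra p = ℤ_p⟦T⟧`
(`T` = weight variable centred at `κ₂`). FIRST LEMMA of the idea: control at weight 2 (`s ≤ rank X/TX`) +
weight-line Euler-system divisibility (`g ∣ J²`, `g ∈ char X`) ⇒ `s ≤ 2·ord_T J` — by the PROVED tree lemma
`IwasawaAlgebra.coinvariantsRank_le_order_of_mem_charIdeal` and `PowerSeries.order_mul`.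
-/

namespace Summit.BirchSwinnertonDyer.BirchSwinnertonDyer.Cruxes.VerticalSelmerBound.LambdaAdicWeightLine

set_option linter.dupNamespace false

open Literature.NumberTheory.EllipticCurves Literature.NumberTheory.EllipticCurves.IwasawaAlgebra

/-- First lemma of the Λ-adic weight-line idea (pure Λ-module algebra, everything else posited as hypotheses):
if `s ≤ rank_{ℤ_p} X/TX` (control of the weight-line Selmer module at `κ₂`), `g ∈ char_Λ X` and `g ∣ J ^ 2`
(Euler-system divisibility on the weight line, `J` = Longo–Vigni's `𝓙₀`), then `s ≤ 2 · ord_T J`. -/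
theorem corankBound_of_weightLineDivisibility (p : ℕ) [Fact p.Prime] (X : Type) [AddCommGroup X]
    [Module (IwasawaAlgebra p) X] [Module.Finite (IwasawaAlgebra p) X]
    (hX : Module.IsTorsion (IwasawaAlgebra p) X) (g J : IwasawaAlgebra p)
    (hg : g ∈ Module.charIdeal (IwasawaAlgebra p) X) (hdiv : g ∣ J ^ 2) (s : ℕ)
    (hs : s ≤ coinvariantsRank p X) : (s : ℕ∞) ≤ 2 * PowerSeries.order J := by
  have h1 : (coinvariantsRank p X : ℕ∞) ≤ PowerSeries.order g :=
    coinvariantsRank_le_order_of_mem_charIdeal X hX g hg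
  obtain ⟨h, hh⟩ := hdiv
  have h2 : PowerSeries.order g ≤ PowerSeries.order (J ^ 2) := by
    rw [hh]
    exact le_trans le_self_add (PowerSeries.order_mul_ge g h)
  have h3 : PowerSeries.order (J ^ 2) = 2 * PowerSeries.order J := by
    rw [pow_two, PowerSeries.order_mul, two_mul]
  calc (s : ℕ∞) ≤ (coinvariantsRank p X : ℕ∞) := by exact_mod_cast hs
    _ ≤ PowerSeries.order g := h1
    _ ≤ PowerSeries.order (J ^ 2) := h2
    _ = 2 * PowerSeries.order J := h3

end Summit.BirchSwinnertonDyer.BirchSwinnertonDyer.Cruxes.VerticalSelmerBound.LambdaAdicWeightLine
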